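import Summits.AtomisticToContinuum.HydrodynamicLimit.Theorems.RelayRaceLocalityRestartPrincipleMeanClosureTools
import Summits.AtomisticToContinuum.HydrodynamicLimit.Theorems.RelayRaceLocalityNearConstantShortTimeHLMeansPin
import Summits.AtomisticToContinuum.HydrodynamicLimit.Theorems.RelayRaceLocalityNearConstantShortTimeHLGeneralFamilyLDA
import Summits.AtomisticToContinuum.HydrodynamicLimit.Theorems.RelayRaceLocalityNearConstantShortTimeHLGeneralFamilyConcentration
import Summits.AtomisticToContinuum.HydrodynamicLimit.Theorems.TwoClocksEntropyToHydro
import Summits.AtomisticToContinuum.HydrodynamicLimit.Theses.ResponseRigidity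
import Literature.MathematicalPhysics.KineticTheory.HardSphereCanonicalTorus
import HarnessLib

/-!
# Crux `RestartPrinciple` (stmt-AtomisticToContinuum-12503), line `IdeatorFourSketch` — stub `stub_meanClosure`

Support file (`--supports stmt-AtomisticToContinuum-12503`) proving the registered stub

  `stub_meanClosure : ResponseRigidity.MeanClosure`

of line `IdeatorFourSketch` (card `age-duhamel-forgetting`; skeleton `Cruxes/RestartPrinciple/Lines/IdeatorFourSketch.lean`).
Its TYPE is literally the shared item stmt-AtomisticToContinuum-11929 of route `ResponseRigidity` — MEAN ⇒ PROBABILITY BY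
ENTROPY SATURATION in the packing-guarded dilute band: if the expectations of the empirical density / momentum / energy
fields at time `t` converge for every smooth `χ`, then the law of large numbers holds at `t` — so `meanClosure_holds` below
settles that item as well.

PROOF (Yau's bookkeeping at the Euler-MATCHED local Gibbs reference, transplanted from the sibling crux
`NearConstantShortTimeHL`, line `means-pin-entropy`, `stub_meansPin`, to the conjunct family `(hsDiameter σ N, N + 1)`):
1. thresholds `η := min(η₁^{LDA}, η₂^{conc}, η^{EOS})` (`stub_ldaGeneralFamilies`, `stub_concentrationGeneralFamilies` — both
   PROVED general-family statics —, `hsEosLowDensity_proof`), `σ₀ := min(1/2, η_A/Λ², η₂/(2Λ²))` with `Λ⁻¹ ≤ a₀ ≤ Λ`;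
2. activity inversion at `t = 0` (`activity_inversion_continuous`): `a₀ = e^c ρst e^{g_σ(ρst)}`, the constant drops out of the
   canonical law, and exponential concentration + the `t = 0` tie identify `(ρst, u₀, θ₀) = (ρ, u, θ)(0)`
   (`profiles_eq_of_tendsto`);
3. the ENGINE SLOT is the hypothesis: the three test functions of the matched log-profile at `t` are smooth on the torus
   (`isSmooth_logProfile_density_test`, `isSmooth_neg_inv`, `isSmooth_div_coord`), the fields at time `t` are integrable
   (`integrable_*Field_flow`), so the expectation of the empirical mean of `Λ_t ∘ Φ_t` tends to its Euler value
   (`eventually_logProfileMean_ge'`);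
4. mass conservation + isentropy (`integral_entropy_eq_of_band_Icc`) give `m₀ − π₀ = m_t − π_t`, and
   `tendsto_klDiv_div_of_means` gives `KL((Φ_N t)_* P_N ‖ Q_N)/(N+1) → 0`;
5. the entropy inequality against the exponential concentration of `Q_N` (`tendstoHydroFieldsAt_of_klDiv`).
No definitions, no sorry. References: H.-T. Yau, Lett. Math. Phys. 22 (1991) §2; S. Olla – S.R.S. Varadhan – H.-T. Yau,
Comm. Math. Phys. 155 (1993) §3; C. Kipnis – C. Landim (1999) Ch. 6.
-/

noncomputable section

namespace Summit.AtomisticToContinuum.HydrodynamicLimit.Theorems.RestartPrinciple.AgeDuhamelForgetting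

open MeasureTheory InformationTheory Set Filter Topology
open scoped ENNReal ContDiff
open Literature.MathematicalPhysics.KineticTheory Literature.Analysis.FluidPDE Literature.Analysis.FunctionSpaces
open Summit.AtomisticToContinuum.HydrodynamicLimit.Theses
open Summit.AtomisticToContinuum.HydrodynamicLimit.Theorems.NearConstantShortTimeHL

/-- **STUB S1 of line `IdeatorFourSketch` = shared item stmt-AtomisticToContinuum-11929 (`ResponseRigidity.MeanClosure`):
MEAN ⇒ PROBABILITY by entropy saturation.** In the dilute band, along every classical hs-Euler solution and every flow
family with the `t = 0` law of large numbers: if at time `t` the EXPECTATIONS of the empirical density / momentum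
(componentwise) / energy fields converge for every smooth `χ`, then `TendstoHydroFieldsAt` holds at `t`. Yau's bookkeeping
at the Euler-matched local Gibbs reference (inverted activity, identified data, pressures and static mean from the
general-family LDA, the engine slot from the hypothesis through the smooth log-profile test functions, isentropy) gives
`KL((Φ_N t)_* P_N ‖ Q_N) = o(N)`, and the entropy inequality against the exponential concentration of `Q_N` concludes.
[cite: Yau1991, §2] -/
theorem stub_meanClosure : ResponseRigidity.MeanClosure := by
  -- statics: general-family LDA (S1), general-family concentration (S2), equation of state, activity inversion
  obtain ⟨η₁, hη₁, H1⟩ := stub_ldaGeneralFamilies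
  obtain ⟨η₂, hη₂, H2⟩ := stub_concentrationGeneralFamilies
  obtain ⟨ηE, hηE, F, hFa, hEqF, hF0, -, -⟩ := hsEosLowDensity_proof
  obtain ⟨ηA, hηA, hinvA⟩ := activity_inversion_continuous hηE hFa hEqF hF0
  have hfex : ContDiffOn ℝ ∞ hsExcessFreeEnergy (Ioo 0 ηE) :=
    (hFa.contDiffOn_of_completeSpace.mono (Ioo_subset_Ioo (by linarith) le_rfl)).congr
      fun r hr => hEqF ⟨hr.1.le, hr.2⟩
  -- the packing threshold
  set η₀ : ℝ := min (min η₁ η₂) ηE with hη₀def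
  have hη₀ : 0 < η₀ := lt_min (lt_min hη₁ hη₂) hηE
  have hη₀₁ : η₀ ≤ η₁ := (min_le_left _ _).trans (min_le_left _ _)
  have hη₀₂ : η₀ ≤ η₂ := (min_le_left _ _).trans (min_le_right _ _)
  have hη₀E : η₀ ≤ ηE := min_le_right _ _
  refine ⟨η₀, hη₀, fun a₀ θ₀ u₀ ha hθ hu ha0 hθ0 => ?_⟩
  -- bounds on the activity profile
  obtain ⟨Aup, -, hAup⟩ := exists_forall_abs_le_of_continuous ha
  obtain ⟨x₀, -, hx₀⟩ := isCompact_univ.exists_isMinOn univ_nonempty ha.continuousOn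
  have hamin : ∀ x, a₀ x₀ ≤ a₀ x := fun x => hx₀ (mem_univ x)
  set Λ : ℝ := max (max Aup (a₀ x₀)⁻¹) 1 with hΛdef
  have hΛ1 : 1 ≤ Λ := le_max_right _ _
  have hΛ0 : 0 < Λ := one_pos.trans_le hΛ1
  have haΛ : ∀ x, Λ⁻¹ ≤ a₀ x ∧ a₀ x ≤ Λ := by
    intro x
    constructor
    · have h1 : (a₀ x₀)⁻¹ ≤ Λ := (le_max_right _ _).trans (le_max_left _ _)
      calc Λ⁻¹ ≤ ((a₀ x₀)⁻¹)⁻¹ := inv_anti₀ (inv_pos.2 (ha0 x₀)) h1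
        _ = a₀ x₀ := inv_inv _
        _ ≤ a₀ x := hamin x
    · exact ((le_abs_self _).trans (hAup x)).trans ((le_max_left _ _).trans (le_max_left _ _))
  -- the threshold in `σ`
  set σA : ℝ := min (1 / 2) (min (ηA / Λ ^ 2) (η₂ / (2 * Λ ^ 2))) with hσAdef
  have hσA : 0 < σA := lt_min one_half_pos (lt_min (by positivity) (by positivity))
  refine ⟨σA, hσA, ?_⟩
  intro σ hσ hσlt T ρ θ u hE hpack Φ h0 t ht hmean
  have hσ2 : σ ≤ 1 / 2 := (hσlt.trans_le (min_le_left _ _)).le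
  have hσ3 : 0 < σ ^ 3 := pow_pos hσ 3
  have hpackA : Λ ^ 2 * σ ^ 3 ≤ ηA := by
    have h1 : σ ≤ ηA / Λ ^ 2 := (hσlt.trans_le ((min_le_right _ _).trans (min_le_left _ _))).le
    rw [le_div_iff₀ (by positivity)] at h1
    have hσ3le : σ ^ 3 ≤ σ := by
      calc σ ^ 3 = σ * (σ * σ) := by ring
        _ ≤ σ * 1 := by gcongr; nlinarith
        _ = σ := mul_one σ
    nlinarith
  have hband2 : 2 * Λ ^ 2 * σ ^ 3 ≤ η₂ := by
    have h1 : σ ≤ η₂ / (2 * Λ ^ 2) := (hσlt.trans_le ((min_le_right _ _).trans (min_le_right _ _))).le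
    rw [le_div_iff₀ (by positivity)] at h1
    have hσ3le : σ ^ 3 ≤ σ := by
      calc σ ^ 3 = σ * (σ * σ) := by ring
        _ ≤ σ * 1 := by gcongr; nlinarith
        _ = σ := mul_one σ
    nlinarith
  -- the conjunct family is admissible
  have hε : ∀ N : ℕ, 0 < hsDiameter σ N := fun N => hsDiameter_pos hσ N
  have hε0 : Tendsto (fun N : ℕ => hsDiameter σ N) atTop (𝓝 0) := tendsto_hsDiameter σ
  have hn : Tendsto (fun N : ℕ => ((N + 1 : ℕ) : ℝ) * hsDiameter σ N ^ 3) atTop (𝓝 (σ ^ 3)) := by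
    have : (fun N : ℕ => ((N + 1 : ℕ) : ℝ) * hsDiameter σ N ^ 3) = fun _ => σ ^ 3 :=
      funext fun N => succ_mul_hsDiameter_pow_three σ N
    rw [this]
    exact tendsto_const_nhds
  have hn_top : Tendsto (fun N : ℕ => N + 1) atTop atTop := tendsto_add_atTop_nat 1
  have htI : t ∈ Ico 0 T := ht
  have htT : t < T := ht.2
  have h0I : (0 : ℝ) ∈ Ico 0 T := ⟨le_rfl, ht.1.trans_lt htT⟩
  have h0t : (0 : ℝ) ∈ Icc 0 t := ⟨le_rfl, ht.1⟩
  have htt : t ∈ Icc 0 t := ⟨ht.1, le_rfl⟩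
  have hg : ∀ s ∈ Icc 0 t, ∀ x, ρ s x * σ ^ 3 < η₀ := fun s hs x => hpack s ⟨hs.1, hs.2.trans_lt htT⟩ x
  -- the local chemical potential correction `g_σ`
  set g : ℝ → ℝ := fun r => hsExcessFreeEnergy (r * σ ^ 3) + r * σ ^ 3 * deriv hsExcessFreeEnergy (r * σ ^ 3)
    with hgdef
  ------------------------------------------------------------------
  -- Step 1: inversion of the activity at `t = 0`
  ------------------------------------------------------------------
  obtain ⟨ρst, hρstc, hρstb, hρst1, c, hc⟩ := hinvA σ hσ Λ hΛ1 hpackA a₀ ha haΛ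
  have hρst0 : ∀ x, 0 < ρst x := fun x => (by positivity : (0 : ℝ) < (2 * Λ ^ 2)⁻¹).trans_le (hρstb x).1
  have ha₀eq : a₀ = fun x => Real.exp c * (ρst x * Real.exp (g (ρst x))) := by
    funext x; rw [hc x]; ring
  subst ha₀eq
  -- the constant drops out: the conjunct's laws ARE the matched laws of `(ρst, u₀, θ₀)`
  have hcd : ∀ N, canonicalDensity (Torus.geometry (Fin 3)) (hsDiameter σ N) (N + 1)
      (localGibbsProfile (fun x => Real.exp c * (ρst x * Real.exp (g (ρst x)))) u₀ θ₀) =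
      canonicalDensity (Torus.geometry (Fin 3)) (hsDiameter σ N) (N + 1)
        (localGibbsProfile (fun x => ρst x * Real.exp (g (ρst x))) u₀ θ₀) := by
    intro N
    funext z
    rw [MacroClosureLine.StubLedger.localGibbsProfile_const_mul]
    exact KineticWindowGronwallNegative.canonicalDensity_const_mul (Real.exp_pos c).ne' _ _ z
  have hPeq : ∀ N, localGibbsLaw σ (fun x => Real.exp c * (ρst x * Real.exp (g (ρst x)))) u₀ θ₀ N (Φ N) =
      particleLaw (Φ N) (canonicalDensity (Torus.geometry (Fin 3)) (hsDiameter σ N) (N + 1)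
        (localGibbsProfile (fun x => ρst x * Real.exp (g (ρst x))) u₀ θ₀)) := fun N => by
    show particleLaw (Φ N) _ = _
    rw [hcd N]
  have hP : ∀ N, IsProbabilityMeasure
      (localGibbsLaw σ (fun x => Real.exp c * (ρst x * Real.exp (g (ρst x)))) u₀ θ₀ N (Φ N)) := fun N =>
    isProbabilityMeasure_localGibbsLaw ha hθ hu ha0 hθ0 hσ2 N (Φ N)
  have hPac : ∀ N, localGibbsLaw σ (fun x => Real.exp c * (ρst x * Real.exp (g (ρst x)))) u₀ θ₀ N (Φ N) ≪
      liouville (Torus.geometry (Fin 3)) (N + 1) (hsDiameter σ N) := fun N => withDensity_absolutelyContinuous _ _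
  ------------------------------------------------------------------
  -- Step 2: identification of the Euler data at `t = 0`
  ------------------------------------------------------------------
  have hS2₀ := H2 σ hσ (2 * Λ ^ 2)⁻¹ (by positivity) ρst hρstc
    (fun x => ⟨(hρstb x).1, (mul_le_mul_of_nonneg_right (hρstb x).2 hσ3.le).trans hband2⟩) hρst1 u₀ θ₀ hu hθ
    hθ0 (fun N => hsDiameter σ N) (fun N => N + 1) hε hε0 hn
  have hident := profiles_eq_of_tendsto
    (P := fun N => localGibbsLaw σ (fun x => Real.exp c * (ρst x * Real.exp (g (ρst x)))) u₀ θ₀ N (Φ N))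
    hP (fun N z χ => empiricalDensityField z χ) (fun N z χ => empiricalMomentumField z χ)
    (fun N z χ => empiricalEnergyField z χ) hρstc hθ hu
    (hE.smooth_density.isSmooth_slice h0I).continuous (hE.smooth_temperature.isSmooth_slice h0I).continuous
    (hE.smooth_velocity.isSmooth_slice h0I).continuous hρst0
    (fun χ hχ δ hδ => by
      obtain ⟨C, hC, hCN⟩ := hS2₀ χ hχ δ hδ
      refine ⟨tendsto_zero_of_le_exp hn_top hC fun N => ?_, tendsto_zero_of_le_exp hn_top hC fun N => ?_,
        tendsto_zero_of_le_exp hn_top hC fun N => ?_⟩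
      · rw [hPeq N]; exact (hCN N).1
      · rw [hPeq N]; exact (hCN N).2.1
      · rw [hPeq N]; exact (hCN N).2.2)
    (fun χ hχ δ hδ => by
      obtain ⟨h1, h2, h3⟩ := h0 χ hχ δ hδ
      refine ⟨h1.congr fun N => ?_, h2.congr fun N => ?_, h3.congr fun N => ?_⟩
      · exact measure_setOf_flow_zero_mem (Φ N) (hPac N) {z | δ < |empiricalDensityField z χ - ∫ x, χ x * ρ 0 x|}
      · exact measure_setOf_flow_zero_mem (Φ N) (hPac N)
          {z | δ < ‖empiricalMomentumField z χ - ∫ x, (χ x * ρ 0 x) • u 0 x‖}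
      · exact measure_setOf_flow_zero_mem (Φ N) (hPac N)
          {z | δ < |empiricalEnergyField z χ - ∫ x, χ x * totalEnergyDensity (ρ 0 x) (u 0 x) (θ 0 x)|})
  obtain ⟨hρst, hu₀, hθ₀⟩ := hident
  subst hρst hu₀ hθ₀
  ------------------------------------------------------------------
  -- Step 3: the data at time `t`
  ------------------------------------------------------------------
  have hρts : Torus.IsSmooth (ρ t) := hE.smooth_density.isSmooth_slice htI
  have hθts : Torus.IsSmooth (θ t) := hE.smooth_temperature.isSmooth_slice htI
  have huts : Torus.IsSmooth (u t) := hE.smooth_velocity.isSmooth_slice htI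
  have hρtc : Continuous (ρ t) := hρts.continuous
  have hθtc : Continuous (θ t) := hθts.continuous
  have hutc : Continuous (u t) := huts.continuous
  have hρt0 : ∀ x, 0 < ρ t x := hE.density_pos t htI
  have hθt0 : ∀ x, 0 < θ t x := hE.temperature_pos t htI
  have hρ00 : ∀ x, 0 < ρ 0 x := hE.density_pos 0 h0I
  have hθ00 : ∀ x, 0 < θ 0 x := hE.temperature_pos 0 h0I
  obtain ⟨xt, -, hxt⟩ := isCompact_univ.exists_isMinOn univ_nonempty hρtc.continuousOn
  have hct : ∀ x, ρ t xt ≤ ρ t x := fun x => hxt (mem_univ x)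
  have hmass : ∫ x, ρ t x = 1 := (DenseExcursionEverywhere.integral_density_eq hE htI).trans hρst1
  have hbandt : ∀ x, ρ t xt ≤ ρ t x ∧ ρ t x * σ ^ 3 ≤ η₁ := fun x =>
    ⟨hct x, ((hg t htt x).le).trans hη₀₁⟩
  have hbandt2 : ∀ x, ρ t xt ≤ ρ t x ∧ ρ t x * σ ^ 3 ≤ η₂ := fun x =>
    ⟨hct x, ((hg t htt x).le).trans hη₀₂⟩
  have hbandtE : ∀ x, ρ t x * σ ^ 3 < ηE := fun x => (hg t htt x).trans_le hη₀E
  obtain ⟨x0m, -, hx0m⟩ := isCompact_univ.exists_isMinOn univ_nonempty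
    (hE.smooth_density.isSmooth_slice h0I).continuous.continuousOn
  have hc0 : ∀ x, ρ 0 x0m ≤ ρ 0 x := fun x => hx0m (mem_univ x)
  have hband0 : ∀ x, ρ 0 x0m ≤ ρ 0 x ∧ ρ 0 x * σ ^ 3 ≤ η₁ := fun x =>
    ⟨hc0 x, ((hg 0 h0t x).le).trans hη₀₁⟩
  -- S1 at `0` and `t`, S2 at `t`
  obtain ⟨hπ₀, hm₀i, hm₀⟩ := H1 σ hσ (ρ 0 x0m) (hρ00 x0m) (ρ 0) hρstc hband0 hρst1 (u 0) (θ 0) hu hθ hθ0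
    (fun N => hsDiameter σ N) (fun N => N + 1) hε hε0 hn
  obtain ⟨hπt, -, -⟩ := H1 σ hσ (ρ t xt) (hρt0 xt) (ρ t) hρtc hbandt hmass (u t) (θ t) hutc hθtc hθt0
    (fun N => hsDiameter σ N) (fun N => N + 1) hε hε0 hn
  have hS2t := H2 σ hσ (ρ t xt) (hρt0 xt) (ρ t) hρtc hbandt2 hmass (u t) (θ t) hutc hθtc hθt0
    (fun N => hsDiameter σ N) (fun N => N + 1) hε hε0 hn
  ------------------------------------------------------------------
  -- Step 4: the engine slot from the hypothesis (smooth test functions, integrable fields, converging means)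
  ------------------------------------------------------------------
  have hθtne : ∀ x, θ t x ≠ 0 := fun x => (hθt0 x).ne'
  have hAs : Torus.IsSmooth (fun x => Real.log (ρ t x) + g (ρ t x) - 3 / 2 * Real.log (2 * Real.pi * θ t x) -
      ‖u t x‖ ^ 2 / (2 * θ t x)) :=
    isSmooth_logProfile_density_test hfex hσ hρts hθts huts hρt0 hθt0 hbandtE
  have hθis : Torus.IsSmooth (fun x => -(θ t x)⁻¹) := isSmooth_neg_inv hθts hθtne
  have huls : ∀ l : Fin 3, Torus.IsSmooth (fun x => u t x l / θ t x) := fun l => isSmooth_div_coord huts hθts hθtne l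
  have hgc : Continuous fun x => g (ρ t x) := by
    have hbs : ∀ x, ρ t x * σ ^ 3 ∈ Ioo 0 ηE := fun x => ⟨mul_pos (hρt0 x) hσ3, hbandtE x⟩
    have hηc : Continuous fun x => ρ t x * σ ^ 3 := hρtc.mul continuous_const
    exact (hfex.continuousOn.comp_continuous hηc hbs).add (hηc.mul
      ((hfex.continuousOn_deriv_of_isOpen isOpen_Ioo (by simp)).comp_continuous hηc hbs))
  have hAc : Continuous fun x => Real.log (ρ t x) + g (ρ t x) - 3 / 2 * Real.log (2 * Real.pi * θ t x) :=
    ((hρtc.log fun x => (hρt0 x).ne').add hgc).sub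
      (continuous_const.mul ((continuous_const.mul hθtc).log fun x =>
        (mul_pos (mul_pos two_pos Real.pi_pos) (hθt0 x)).ne'))
  -- bounds on the three (continuous) test functions
  have hχ₁c : Continuous fun x => Real.log (ρ t x) + g (ρ t x) - 3 / 2 * Real.log (2 * Real.pi * θ t x) -
      ‖u t x‖ ^ 2 / (2 * θ t x) := hAs.continuous
  have hχ₂c : Continuous fun x => -(θ t x)⁻¹ := hθis.continuous
  have hχ₃c : ∀ l : Fin 3, Continuous fun x => u t x l / θ t x := fun l => (huls l).continuous
  obtain ⟨C₁, hC₁0, hC₁⟩ := exists_forall_abs_le_of_continuous hχ₁c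
  obtain ⟨C₂, hC₂0, hC₂⟩ := exists_forall_abs_le_of_continuous hχ₂c
  have hC₃ := fun l => exists_forall_abs_le_of_continuous (hχ₃c l)
  have ha0' : ∀ x, 0 ≤ Real.exp c * (ρ 0 x * Real.exp (g (ρ 0 x))) := fun x => (ha0 x).le
  have hS3 : ∀ κ : ℝ, 0 < κ → ∀ᶠ N : ℕ in atTop,
      Integrable (fun z => ∫ y, ((Real.log (ρ t y.1) + g (ρ t y.1) - 3 / 2 * Real.log (2 * Real.pi * θ t y.1)) -
        ‖y.2 - u t y.1‖ ^ 2 / (2 * θ t y.1)) ∂(empiricalMeasure ((Φ N).flow t z)))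
        (localGibbsLaw σ (fun x => Real.exp c * (ρ 0 x * Real.exp (g (ρ 0 x)))) (u 0) (θ 0) N (Φ N)) ∧
      (∫ x, ρ t x * ((Real.log (ρ t x) + g (ρ t x) - 3 / 2 * Real.log (2 * Real.pi * θ t x)) - 3 / 2)) - κ ≤
        ∫ z, (∫ y, ((Real.log (ρ t y.1) + g (ρ t y.1) - 3 / 2 * Real.log (2 * Real.pi * θ t y.1)) -
          ‖y.2 - u t y.1‖ ^ 2 / (2 * θ t y.1)) ∂(empiricalMeasure ((Φ N).flow t z)))
          ∂(localGibbsLaw σ (fun x => Real.exp c * (ρ 0 x * Real.exp (g (ρ 0 x)))) (u 0) (θ 0) N (Φ N)) := by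
    intro κ hκ
    refine eventually_logProfileMean_ge' Φ
      (fun N => localGibbsLaw σ (fun x => Real.exp c * (ρ 0 x * Real.exp (g (ρ 0 x)))) (u 0) (θ 0) N (Φ N)) t
      (A := fun x => Real.log (ρ t x) + g (ρ t x) - 3 / 2 * Real.log (2 * Real.pi * θ t x))
      hρtc hθtc hAc hutc hθtne (Eventually.of_forall fun N => ⟨?_, ?_, fun l => ?_⟩) ?_ ?_ (fun l => ?_) hκ
    · haveI := hP N
      exact integrable_densityField_flow (Φ N) _ hχ₁c hC₁ hC₁0 t
    · haveI := hP N
      exact integrable_energyField_flow (Φ N) ha hθ hu ha0' hθ0 hχ₂c hC₂ hC₂0 t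
    · haveI := hP N
      obtain ⟨C₃, hC₃0, hC₃'⟩ := hC₃ l
      exact integrable_momentumField_flow (Φ N) ha hθ hu ha0' hθ0 (hχ₃c l) hC₃' hC₃0 t l
    · exact (hmean _ hAs).1
    · exact (hmean _ hθis).2.2
    · exact (hmean _ (huls l)).2.1 l
  ------------------------------------------------------------------
  -- Step 5: the bookkeeping identity `m₀ − π₀ = m_t − π_t` (mass conservation + isentropy)
  ------------------------------------------------------------------
  have hEnt := integral_entropy_eq_of_band_Icc hσ hfex hE htI (fun s hs x => (hg s hs x).trans_le hη₀E)
  have hMass := DenseExcursionEverywhere.integral_density_eq hE htI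
  have hsplit : ∀ s ∈ Icc 0 t,
      (∫ x, ρ s x * (Real.log (ρ s x) + g (ρ s x) - 3 / 2 * Real.log (2 * Real.pi * θ s x) - 3 / 2)) -
        ∫ x, ρ s x * (ρ s x * σ ^ 3 * deriv hsExcessFreeEnergy (ρ s x * σ ^ 3)) =
      -(∫ x, ρ s x * (3 / 2 * Real.log (θ s x) - Real.log (ρ s x) - hsExcessFreeEnergy (ρ s x * σ ^ 3))) -
        (3 / 2 * Real.log (2 * Real.pi) + 3 / 2) * ∫ x, ρ s x := by
    intro s hs
    have hsT : s ∈ Ico 0 T := ⟨hs.1, hs.2.trans_lt htT⟩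
    have hρc := (hE.smooth_density.isSmooth_slice hsT).continuous
    have hθc := (hE.smooth_temperature.isSmooth_slice hsT).continuous
    have hρp := hE.density_pos s hsT
    have hθp := hE.temperature_pos s hsT
    have hbs : ∀ x, ρ s x * σ ^ 3 ∈ Ioo 0 ηE := fun x =>
      ⟨mul_pos (hρp x) hσ3, (hg s hs x).trans_le hη₀E⟩
    have hηc : Continuous fun x => ρ s x * σ ^ 3 := hρc.mul continuous_const
    have hfc : Continuous fun x => hsExcessFreeEnergy (ρ s x * σ ^ 3) :=
      hfex.continuousOn.comp_continuous hηc hbs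
    have hf'c : Continuous fun x => deriv hsExcessFreeEnergy (ρ s x * σ ^ 3) :=
      (hfex.continuousOn_deriv_of_isOpen isOpen_Ioo (by simp)).comp_continuous hηc hbs
    have hlogρ : Continuous fun x => Real.log (ρ s x) := hρc.log fun x => (hρp x).ne'
    have hlogθ : Continuous fun x => Real.log (θ s x) := hθc.log fun x => (hθp x).ne'
    have hlog2θ : Continuous fun x => Real.log (2 * Real.pi * θ s x) :=
      (continuous_const.mul hθc).log fun x => (mul_pos (mul_pos two_pos Real.pi_pos) (hθp x)).ne'
    have hi1 : Integrable (fun x => ρ s x * (Real.log (ρ s x) + g (ρ s x) -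
        3 / 2 * Real.log (2 * Real.pi * θ s x) - 3 / 2)) := by
      refine integrable_of_continuous_T3 (hρc.mul ?_)
      exact (((hlogρ.add (hfc.add (hηc.mul hf'c))).sub (continuous_const.mul hlog2θ)).sub continuous_const)
    have hi2 : Integrable (fun x => ρ s x * (ρ s x * σ ^ 3 * deriv hsExcessFreeEnergy (ρ s x * σ ^ 3))) :=
      integrable_of_continuous_T3 (hρc.mul (hηc.mul hf'c))
    have hi3 : Integrable (fun x => ρ s x * (3 / 2 * Real.log (θ s x) - Real.log (ρ s x) -
        hsExcessFreeEnergy (ρ s x * σ ^ 3))) :=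
      integrable_of_continuous_T3 (hρc.mul (((continuous_const.mul hlogθ).sub hlogρ).sub hfc))
    have hi4 : Integrable (ρ s) := integrable_of_continuous_T3 hρc
    have hpt : (fun x => ρ s x * (Real.log (ρ s x) + g (ρ s x) - 3 / 2 * Real.log (2 * Real.pi * θ s x) - 3 / 2) -
        ρ s x * (ρ s x * σ ^ 3 * deriv hsExcessFreeEnergy (ρ s x * σ ^ 3))) =
        fun x => -(ρ s x * (3 / 2 * Real.log (θ s x) - Real.log (ρ s x) - hsExcessFreeEnergy (ρ s x * σ ^ 3))) -
          (3 / 2 * Real.log (2 * Real.pi) + 3 / 2) * ρ s x := by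
      funext x
      have hl : Real.log (2 * Real.pi * θ s x) = Real.log (2 * Real.pi) + Real.log (θ s x) :=
        Real.log_mul (mul_pos two_pos Real.pi_pos).ne' (hθp x).ne'
      simp only [hgdef, hl]
      ring
    rw [← integral_sub hi1 hi2, hpt, integral_sub hi3.fun_neg (hi4.const_mul _), integral_neg, integral_const_mul]
  have hid : (∫ x, ρ 0 x * (Real.log (ρ 0 x) + g (ρ 0 x) - 3 / 2 * Real.log (2 * Real.pi * θ 0 x) - 3 / 2)) -
        (∫ x, ρ 0 x * (ρ 0 x * σ ^ 3 * deriv hsExcessFreeEnergy (ρ 0 x * σ ^ 3))) =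
      (∫ x, ρ t x * (Real.log (ρ t x) + g (ρ t x) - 3 / 2 * Real.log (2 * Real.pi * θ t x) - 3 / 2)) -
        ∫ x, ρ t x * (ρ t x * σ ^ 3 * deriv hsExcessFreeEnergy (ρ t x * σ ^ 3)) := by
    rw [hsplit 0 h0t, hsplit t htt, hEnt, hMass]
  ------------------------------------------------------------------
  -- Step 6: `KL((Φ_N t)_* P_N ‖ Q_N)/(N+1) → 0` and the entropy inequality at `t`
  ------------------------------------------------------------------
  have hpc : Continuous fun x => ρ 0 x * Real.exp (g (ρ 0 x)) := by
    have hbs : ∀ x, ρ 0 x * σ ^ 3 ∈ Ioo 0 ηE := fun x =>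
      ⟨mul_pos (hρ00 x) hσ3, (hg 0 h0t x).trans_le hη₀E⟩
    have hηc : Continuous fun x => ρ 0 x * σ ^ 3 := hρstc.mul continuous_const
    exact hρstc.mul (((hfex.continuousOn.comp_continuous hηc hbs).add (hηc.mul
      ((hfex.continuousOn_deriv_of_isOpen isOpen_Ioo (by simp)).comp_continuous hηc hbs))).rexp)
  have hqc : Continuous fun x => ρ t x * Real.exp (g (ρ t x)) := hρtc.mul hgc.rexp
  have hp0 : ∀ x, 0 < ρ 0 x * Real.exp (g (ρ 0 x)) := fun x => mul_pos (hρ00 x) (Real.exp_pos _)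
  have hq0 : ∀ x, 0 < ρ t x * Real.exp (g (ρ t x)) := fun x => mul_pos (hρt0 x) (Real.exp_pos _)
  have key := tendsto_klDiv_div_of_means Φ hn_top
    (measurable_localGibbsProfile hpc hθ hu) (measurable_localGibbsProfile hqc hθtc hutc)
    (fun y => mul_pos (hp0 _) (localMaxwellian_pos one_pos (hθ00 _) _ _))
    (fun y => mul_pos (hq0 _) (localMaxwellian_pos one_pos (hθt0 _) _ _))
    (fun N hZN => canonicalPartition_localGibbs_pos_of_ne_zero hpc hθ hu hp0 hθ00 hqc hθtc hutc hq0 hθt0 hZN)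
    (fun N => localGibbsLaw σ (fun x => Real.exp c * (ρ 0 x * Real.exp (g (ρ 0 x)))) (u 0) (θ 0) N (Φ N))
    hPeq hP (log_localGibbsProfile_matched g hρ00 hθ00) (log_localGibbsProfile_matched g hρt0 hθt0) t
    hπ₀ hπt hm₀i hm₀ hS3 hid
  -- the reference laws at `t` are probability measures and concentrate exponentially
  have hQ : ∀ N, IsProbabilityMeasure (localGibbsLaw σ (fun x => ρ t x * Real.exp (g (ρ t x))) (u t) (θ t) N (Φ N)) :=
    fun N => isProbabilityMeasure_localGibbsLaw hqc hθtc hutc hq0 hθt0 hσ2 N (Φ N)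
  haveI : ∀ N, IsFiniteMeasure
      (localGibbsLaw σ (fun x => Real.exp c * (ρ 0 x * Real.exp (g (ρ 0 x)))) (u 0) (θ 0) N (Φ N)) := fun N => by
    haveI := hP N; infer_instance
  haveI : ∀ N, IsFiniteMeasure (localGibbsLaw σ (fun x => ρ t x * Real.exp (g (ρ t x))) (u t) (θ t) N (Φ N)) :=
    fun N => by haveI := hQ N; infer_instance
  refine tendstoHydroFieldsAt_of_klDiv (a := fun x => ρ t x * Real.exp (g (ρ t x))) Φ ?_ ?_
  · intro χ hχ δ hδ
    obtain ⟨C, hC, hCN⟩ := hS2t χ hχ δ hδ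
    refine ⟨C, hC, fun N => ?_⟩
    have h := hCN N
    push_cast at h
    exact h
  · refine key.congr' (Eventually.of_forall fun N => ?_)
    push_cast
    rfl

/-- **Item stmt-AtomisticToContinuum-11929 `ResponseRigidity.MeanClosure` holds** (the same theorem under the route's
naming convention, so the shared item closes by name). [cite: Yau1991, §2] -/
theorem meanClosure_holds : ResponseRigidity.MeanClosure := stub_meanClosure

end Summit.AtomisticToContinuum.HydrodynamicLimit.Theorems.RestartPrinciple.AgeDuhamelForgetting

end
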